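import Literature.MathematicalPhysics.QuantumManyBody.PeriodicBoseGasProofs
import Literature.MathematicalPhysics.QuantumManyBody.PeriodicBoseGasLemma32
import Mathlib.MeasureTheory.Integral.Marginal
import Mathlib.Analysis.Calculus.FDeriv.Pi
import Mathlib.Analysis.Calculus.FDeriv.Comp
import Mathlib.Analysis.Calculus.FDeriv.Measurable
import Mathlib.MeasureTheory.Constructions.Polish.Basic
import Mathlib.Analysis.Convolution
import Mathlib.MeasureTheory.Group.LIntegral
import HarnessLib

/-!
# Fournais 2020, Theorem 3.1 from its four printed ingredients ((3.14)–(3.17))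

Topic `Literature/MathematicalPhysics/QuantumManyBody`, sibling of `PeriodicBoseGas.lean`
(provefact `Literature.MathematicalPhysics.QuantumManyBody.BoseGas.Fournais2020_condensation`). `PeriodicBoseGasProofs.lean` reduces
[Fournais2020, Thm. 1.2] (`Fournais2020_condensation`) to [Fournais2020, Thm. 3.1]
(`Fournais2020_thm31`); `PeriodicBoseGasLocalization.lean` vendors the four ingredients of the
printed proof of Thm. 3.1 (pp. 14–16): the scattering solution (`LSSY2005_scatteringSolution`),
the potential-energy sliding identity Lemma 3.2 (`Fournais2020_lemma32`), the kinetic-energy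
sliding inequality Lemma 3.3 (`Fournais2020_lemma33`) and the small-box bound (3.17)
(`Fournais2020_eq317`, = Thm. 2.1 transported to the sliding boxes `Λ(u)`). This file proves the
step the paper dispatches in one sentence — "By combining Lemmas 3.3 and 3.2, we see that
`H_{ρ_μ,N} ≥ ℓ⁻³ ∫_Ω (H_{Λ(u)}(ρ_μ))_N du` (3.14) … Upon inserting (3.17) in (3.14), we get the
desired bound" — as an honest `N`-body Fubini/Tonelli argument on `ℝ≥0∞`-valued quadratic forms:

* `Fournais2020_thm31_of_localization` —
  `LSSY2005_scatteringSolution → Fournais2020_lemma33 → Fournais2020_eq317 → Fournais2020_thm31`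
  (Lemma 3.2 enters through its proof `Fournais2020_lemma32_holds` of
  `PeriodicBoseGasLemma32.lean`);
* `Fournais2020_condensation_of_localization` — composed with
  `Fournais2020_condensation_of_thm31`: Thm. 1.2 from the three remaining named ingredients.

## The argument [(3.14)–(3.17), pp. 15–16]

For a normalised periodic `C¹` state `Ψ` on `Ω^N` (`Ω = [0,L)³`), with `g = 2π²L⁻²`:

1. *Kinetic part.* Lemma 3.3 is a one-body form inequality; applied to every slice
   `x ↦ Ψ(x₁,…,x_{i-1},x,x_{i+1},…)` (periodic and `C¹`), integrated over the other variables and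
   summed over `i` it gives `∑ᵢ⟨Ψ,(ℓ⁻³∫_Ω T_u^{(i)}du)Ψ⟩ + gN ≤ ⟨Ψ,∑ᵢ(-Δᵢ)Ψ⟩ + g⟨Ψ,n₀Ψ⟩`
   (`kinetic_bound_of_lemma33`): the three one-body terms summed over the particles are the
   kinetic energy (chain rule for slices, `sum_lintegral_gradSqC_slice`), `N‖Ψ‖² = N`
   (`lintegral_normSq_slice`) and the condensate occupation `⟨Ψ,n₀Ψ⟩ = N L⁻³∫|∫_Ω Ψ(x,Y)dx|²dY`
   (Bose symmetry, `sum_lintegral_sliceMeanSq`, `condensateOccupation_succ`). The slice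
   integrals are organised by `∫_{Ω^N}∫_Ω H(update X i x) dx dX = L³∫_{Ω^N} H`
   (`lintegral_cellN_lintegral_update`, via `lmarginal`).
2. *Potential part.* Lemma 3.2 rewrites `∑_{i<j}v^per` and `ρ_μ∑ᵢ∫g(xᵢ-y)dy = 8πaρ_μN` (by
   `∫g = 8πa`, (A.5), translation invariance and `‖Ψ‖ = 1`) as `ℓ⁻³∫_Ω du` of the localised
   potentials; Tonelli swaps `u` and `X` (`lintegral_rep_swap`, `lintegral_attr_eq`; the joint
   measurability of all localised objects in `(u, X)` is the section `Measurability`).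
3. *(3.17) under `ℓ⁻³∫_Ω du`* contributes `ℓ⁻³ · L³ · 4πρ_μ²aℓ³(1 + C₀(ρ_μa³)^{1/2}) =
   4πρ_μ²aL³(1 + C₀(ρ_μa³)^{1/2})` (`lintegral_e317`), and the kinetic terms are matched after one
   more Tonelli (`lintegral_kinLocN_swap`).
4. *Parameters.* `χ` is any localisation function (`exists_isLocalizationFunction`); `b, s₀` from
   Lemma 3.3; `K = K₀(v, ω, χ, b, s₀)` and `C₀, c` from (3.17); the well-definedness of `W`
   (`(χ*χ)(y) > 0` for `|y| ≤ R/ℓ`, hypothesis of Lemma 3.2) holds once `R/ℓ ≤ D` where `χ*χ > 0`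
   on `B_D` (`exists_selfConv_pos`: `χ*χ` is continuous with `(χ*χ)(0) = ∫χ² = 1`), i.e. for
   `ρ_μa³ ≤ (D/(RK₀))²a²` — part of "`ρ_μa³` sufficiently small"; likewise `R ≤ ℓ`.

## References

* [Fournais2020] S. Fournais, *Length scales for BEC in the dilute Bose gas*, arXiv:2011.00309,
  EMS Ser. Congr. Rep. 18 (2021), doi:10.4171/ecr/18-1/7: Thm. 3.1, (3.1)–(3.2), Lemmas 3.2–3.3,
  (3.10)–(3.17), (1.3)–(1.5), (A.5).
* [BrietzkeFournaisSolovej2020] B. Brietzke, S. Fournais, J. P. Solovej, *A simple 2nd order lower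
  bound to the energy of dilute Bose gases*, Comm. Math. Phys. 376 (2020) 323–351,
  arXiv:1901.00539: (5.8)–(5.9) (well-definedness of `W`).
-/

noncomputable section

open MeasureTheory Filter Metric WithLp
open scoped ENNReal NNReal FourierTransform

namespace Literature.MathematicalPhysics.QuantumManyBody.BoseGas

/-- The partial gradient in particle `i`: `|∇ᵢΨ(X)|² = ∑ₖ |∂Ψ/∂x_{i,k}(X)|²` (local notation for
the `i`-th summand of `kineticDensity`). -/
local notation "gradSqAt[" i ", " Ψ ", " X "]" =>
  ∑ k : Fin 3, (‖fderiv ℝ Ψ X (Pi.single i (EuclideanSpace.single k (1 : ℝ)))‖₊ : ℝ≥0∞) ^ 2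

/-- The squared box average of the `i`-th slice, `|∫_Ω Ψ(…, xᵢ = x, …) dx|²` (local notation). -/
local notation "sliceMeanSq[" L ", " i ", " Ψ ", " X "]" =>
  (‖∫ x in cell L, Ψ (Function.update X i x)‖₊ : ℝ≥0∞) ^ 2

/-! ### Slices of `N`-body functions (the Fubini bookkeeping behind (3.14)) -/

section Slices

variable {N : ℕ} {L : ℝ}

/-- `Ω^N` is a product set. [folklore] -/
theorem cellN_eq_pi (N : ℕ) (L : ℝ) : cellN N L = Set.univ.pi fun _ : Fin N => cell L := by
  ext X; simp [cellN]

/-- `Ω^N` is measurable. [folklore] -/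
theorem measurableSet_cellN (N : ℕ) (L : ℝ) : MeasurableSet (cellN N L) := by
  rw [cellN_eq_pi]
  exact MeasurableSet.univ_pi fun _ => measurableSet_cell L

/-- Lebesgue measure restricted to `Ω^N` is the product of Lebesgue measures restricted to `Ω`.
[folklore] -/
theorem volume_restrict_cellN (N : ℕ) (L : ℝ) :
    (volume : Measure (Config N)).restrict (cellN N L) =
      Measure.pi fun _ : Fin N => (volume : Measure Space).restrict (cell L) := by
  rw [cellN_eq_pi, volume_pi, Measure.restrict_pi_pi]

/-- **Slice integration.** `∫_{Ω^N} ∫_Ω H(x₁,…,x_{i-1},x,x_{i+1},…) dx dX = L³ ∫_{Ω^N} H`: the inner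
integral does not depend on `xᵢ`, whose integration produces `|Ω| = L³`. [folklore] -/
theorem lintegral_cellN_lintegral_update (i : Fin N) {H : Config N → ℝ≥0∞} (hH : Measurable H) :
    ∫⁻ X in cellN N L, ∫⁻ x in cell L, H (Function.update X i x) =
      ENNReal.ofReal L ^ 3 * ∫⁻ X in cellN N L, H X := by
  classical
  rw [volume_restrict_cellN]
  set μ : Fin N → Measure Space := fun _ => volume.restrict (cell L) with hμ
  have h1 : (fun X => ∫⁻ x in cell L, H (Function.update X i x)) = ∫⋯∫⁻_{i}, H ∂μ := by
    rw [lmarginal_singleton]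
  rw [h1, lintegral_eq_lmarginal_univ (0 : Config N), lintegral_eq_lmarginal_univ (0 : Config N)]
  have huniv : (Finset.univ : Finset (Fin N)) = {i}ᶜ ∪ {i} := by simp
  rw [huniv, lmarginal_union μ _ hH disjoint_compl_left,
    lmarginal_union μ _ (hH.lmarginal μ) disjoint_compl_left]
  have h2 : ∫⋯∫⁻_{i}, (∫⋯∫⁻_{i}, H ∂μ) ∂μ = fun X => ENNReal.ofReal L ^ 3 * (∫⋯∫⁻_{i}, H ∂μ) X := by
    funext X
    rw [lmarginal_singleton (∫⋯∫⁻_{i}, H ∂μ) i]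
    simp only [lmarginal_update_of_mem μ (Finset.mem_singleton_self i)]
    rw [lintegral_const, Measure.restrict_apply_univ, volume_cell, mul_comm]
  rw [h2]
  simp only [lmarginal]
  rw [lintegral_const_mul' _ _ (ENNReal.pow_ne_top ENNReal.ofReal_ne_top)]

/-- Relabelling particles preserves integrals over `Ω^N`. [folklore] -/
theorem lintegral_cellN_comp_perm (σ : Equiv.Perm (Fin N)) (F : Config N → ℝ≥0∞) :
    ∫⁻ X in cellN N L, F (X ∘ σ) = ∫⁻ X in cellN N L, F X := by
  set e := (MeasurableEquiv.piCongrLeft (fun _ : Fin N => Space) σ).symm with he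
  have hmp : MeasurePreserving e volume volume :=
    (volume_measurePreserving_piCongrLeft (fun _ : Fin N => Space) σ).symm
  have heX : ∀ (X : Config N) (j : Fin N), e X j = X (σ j) := fun X j => rfl
  have hpre : e ⁻¹' cellN N L = cellN N L := by
    ext X
    simp only [Set.mem_preimage, cellN, Set.mem_setOf_eq, heX]
    exact ⟨fun h i => by simpa using h (σ.symm i), fun h i => h _⟩
  have key := hmp.setLIntegral_comp_preimage_emb e.measurableEmbedding F (cellN N L)
  rw [hpre] at key
  exact key

/-- Bose symmetry moves the distinguished slot: `Ψ(update X i x) = Ψ(update (X ∘ σ) 0 x)` for the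
transposition `σ = (0 i)`. [folklore] -/
theorem update_comp_swap {n : ℕ} (X : Config (n + 1)) (i : Fin (n + 1)) (x : Space) :
    Function.update X i x ∘ Equiv.swap 0 i = Function.update (X ∘ Equiv.swap 0 i) 0 x := by
  rw [Function.update_comp_equiv]
  simp

/-- `|∇Ψ|² = ∑ᵢ |∇ᵢΨ|²`. [folklore] -/
theorem kineticDensity_eq_sum_gradSqAt (Ψ : Config N → ℂ) (X : Config N) :
    kineticDensity Ψ X = ∑ i, gradSqAt[i, Ψ, X] := rfl

/-- Chain rule for slices: the gradient of `x ↦ Ψ(update X i x)` at `x` is the `i`-th partial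
gradient of `Ψ` at `update X i x`. [folklore] -/
theorem gradSqC_slice {Ψ : Config N → ℂ} (hΨ : Differentiable ℝ Ψ) (X : Config N) (i : Fin N)
    (x : Space) :
    gradSqC (fun y => Ψ (Function.update X i y)) x = gradSqAt[i, Ψ, Function.update X i x] := by
  unfold gradSqC
  refine Finset.sum_congr rfl fun k _ => ?_
  have h := hasFDerivAt_update (𝕜 := ℝ) X (i := i) x
  have harg : (ContinuousLinearMap.pi (Pi.single i (ContinuousLinearMap.id ℝ Space)) :
      Space →L[ℝ] Config N) (EuclideanSpace.single k 1) =
        Pi.single i (EuclideanSpace.single k (1 : ℝ)) := by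
    funext j
    by_cases hj : j = i
    · subst hj; simp
    · simp [hj]
  rw [show (fun y => Ψ (Function.update X i y)) = Ψ ∘ Function.update X i from rfl,
    fderiv_comp x (hΨ _) h.differentiableAt, h.fderiv, ContinuousLinearMap.comp_apply, harg]

/-- `|∇ᵢΨ|²` is measurable (for any `Ψ`: `fderiv` is measurable). [folklore] -/
theorem measurable_gradSqAt (i : Fin N) (Ψ : Config N → ℂ) :
    Measurable fun X => gradSqAt[i, Ψ, X] := by
  refine Finset.measurable_sum _ fun k _ => ?_
  exact ((measurable_fderiv_apply_const ℝ Ψ _).nnnorm.coe_nnreal_ennreal).pow_const _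

end Slices

/-! ### The three one-body terms of Lemma 3.3, summed over the particles -/

section OneBodySums

variable {N : ℕ} {L : ℝ}

/-- `∑ᵢ L⁻³ ∫_{Ω^N}∫_Ω |∇(slice)|² = ∫_{Ω^N} |∇Ψ|²`. [folklore] -/
theorem sum_lintegral_gradSqC_slice (hL : 0 < L) {Ψ : Config N → ℂ} (hΨ : Differentiable ℝ Ψ) :
    ∑ i : Fin N, (ENNReal.ofReal L ^ 3)⁻¹ *
        ∫⁻ X in cellN N L, ∫⁻ x in cell L, gradSqC (fun y => Ψ (Function.update X i y)) x =
      ∫⁻ X in cellN N L, kineticDensity Ψ X := by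
  have hL3 : ENNReal.ofReal L ^ 3 ≠ 0 := pow_ne_zero _ (by simpa using hL)
  have hL3' : ENNReal.ofReal L ^ 3 ≠ ⊤ := ENNReal.pow_ne_top ENNReal.ofReal_ne_top
  simp only [gradSqC_slice hΨ]
  simp only [kineticDensity_eq_sum_gradSqAt]
  rw [lintegral_finsetSum _ fun i _ => measurable_gradSqAt i Ψ]
  refine Finset.sum_congr rfl fun i _ => ?_
  rw [lintegral_cellN_lintegral_update i (measurable_gradSqAt i Ψ), ← mul_assoc,
    ENNReal.inv_mul_cancel hL3 hL3', one_mul]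

/-- `∫_{Ω^N}∫_Ω |slice|² = L³ ∫_{Ω^N} |Ψ|²`. [folklore] -/
theorem lintegral_normSq_slice (i : Fin N) {Ψ : Config N → ℂ} (hΨ : Measurable Ψ) :
    ∫⁻ X in cellN N L, ∫⁻ x in cell L, (‖Ψ (Function.update X i x)‖₊ : ℝ≥0∞) ^ 2 =
      ENNReal.ofReal L ^ 3 * ∫⁻ X in cellN N L, (‖Ψ X‖₊ : ℝ≥0∞) ^ 2 :=
  lintegral_cellN_lintegral_update i (H := fun X => (‖Ψ X‖₊ : ℝ≥0∞) ^ 2)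
    (hΨ.nnnorm.coe_nnreal_ennreal.pow_const _)

/-- The `i`-th slice average does not depend on `xᵢ`. [folklore] -/
theorem sliceMeanSq_update (L : ℝ) (i : Fin N) (Ψ : Config N → ℂ) (X : Config N) (y : Space) :
    sliceMeanSq[L, i, Ψ, Function.update X i y] = sliceMeanSq[L, i, Ψ, X] := by
  simp

/-- Measurability of the box average of a slice of a continuous function. [folklore] -/
theorem measurable_sliceMeanSq (L : ℝ) (i : Fin N) {Ψ : Config N → ℂ} (hΨ : Continuous Ψ) :
    Measurable fun X => sliceMeanSq[L, i, Ψ, X] := by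
  have h : StronglyMeasurable
      (Function.uncurry fun (X : Config N) (x : Space) => Ψ (Function.update X i x)) := by
    refine (hΨ.comp ?_).stronglyMeasurable
    exact continuous_fst.update i continuous_snd
  have h2 : StronglyMeasurable fun X : Config N => ∫ x in cell L, Ψ (Function.update X i x) :=
    h.integral_prod_right' (ν := volume.restrict (cell L))
  exact (h2.measurable.nnnorm.coe_nnreal_ennreal).pow_const _

/-- Bose symmetry: the `i`-th slice average equals the `0`-th after relabelling. [folklore] -/
theorem sliceMeanSq_eq_zero_comp_swap {n : ℕ} (L : ℝ) (i : Fin (n + 1)) {Ψ : Config (n + 1) → ℂ}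
    (hsymm : ∀ (σ : Equiv.Perm (Fin (n + 1))) (X : Config (n + 1)), Ψ (X ∘ σ) = Ψ X)
    (X : Config (n + 1)) :
    sliceMeanSq[L, i, Ψ, X] = sliceMeanSq[L, 0, Ψ, X ∘ Equiv.swap 0 i] := by
  have h : (fun x => Ψ (Function.update X i x)) =
      fun x => Ψ (Function.update (X ∘ Equiv.swap 0 i) 0 x) :=
    funext fun x => by rw [← hsymm (Equiv.swap 0 i) (Function.update X i x), update_comp_swap]
  rw [h]

/-- `∫_{Ω^{n+1}} |mean of 0-th slice|² = L³ ∫_{Ω^n} |∫_Ω Ψ(x, Y) dx|² dY`. [folklore] -/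
theorem lintegral_sliceMeanSq_zero {n : ℕ} (L : ℝ) {Ψ : Config (n + 1) → ℂ} (hΨ : Continuous Ψ) :
    ∫⁻ X in cellN (n + 1) L, sliceMeanSq[L, 0, Ψ, X] =
      ENNReal.ofReal L ^ 3 *
        ∫⁻ Y in cellN n L, (‖∫ x in cell L, Ψ (Matrix.vecCons x Y)‖₊ : ℝ≥0∞) ^ 2 := by
  set μ : Fin (n + 1) → Measure Space := fun _ => volume.restrict (cell L) with hμ
  have hmp := measurePreserving_piFinSuccAbove μ 0
  rw [volume_restrict_cellN, volume_restrict_cellN,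
    hmp.symm.lintegral_map_equiv (fun X => sliceMeanSq[L, 0, Ψ, X])]
  have hG : ∀ z : Space × Config n,
      sliceMeanSq[L, 0, Ψ, (MeasurableEquiv.piFinSuccAbove (fun _ => Space) 0).symm z] =
        (‖∫ x in cell L, Ψ (Matrix.vecCons x z.2)‖₊ : ℝ≥0∞) ^ 2 := by
    rintro ⟨y, Y⟩
    have : (MeasurableEquiv.piFinSuccAbove (fun _ : Fin (n + 1) => Space) 0).symm (y, Y) =
        Matrix.vecCons y Y := by
      change Fin.insertNth 0 y Y = (Fin.cons y Y : Config (n + 1))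
      exact Fin.insertNth_zero' y Y
    rw [this]
    simp only [Matrix.vecCons, Fin.update_cons_zero]
  simp only [hG]
  have hmeas : Measurable fun Y : Config n =>
      (‖∫ x in cell L, Ψ (Matrix.vecCons x Y)‖₊ : ℝ≥0∞) ^ 2 := by
    have h : StronglyMeasurable
        (Function.uncurry fun (Y : Config n) (x : Space) => Ψ (Matrix.vecCons x Y)) := by
      refine (hΨ.comp ?_).stronglyMeasurable
      exact continuous_snd.matrixVecCons continuous_fst
    exact ((h.integral_prod_right'
      (ν := volume.restrict (cell L))).measurable.nnnorm.coe_nnreal_ennreal).pow_const _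
  rw [lintegral_prod (fun z : Space × Config n =>
      (‖∫ x in cell L, Ψ (Matrix.vecCons x z.2)‖₊ : ℝ≥0∞) ^ 2) (hmeas.comp measurable_snd).aemeasurable]
  simp only
  rw [lintegral_const, Measure.restrict_apply_univ, volume_cell, mul_comm]

end OneBodySums

section Condensate

variable {L : ℝ}

/-- `‖L^{-3/2}‖² = L⁻³` in `ℝ≥0∞`. [folklore] -/
theorem nnnorm_constantMode_sq (hL : 0 < L) :
    ((‖((Real.sqrt (L ^ 3))⁻¹ : ℂ)‖₊ : ℝ≥0∞) ^ 2) = (ENNReal.ofReal L ^ 3)⁻¹ := by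
  have hL3 : 0 < L ^ 3 := by positivity
  have hc : ((‖((Real.sqrt (L ^ 3))⁻¹ : ℂ)‖₊ : ℝ≥0∞) ^ 2) = ENNReal.ofReal ((L ^ 3)⁻¹) := by
    rw [← ENNReal.coe_pow, ENNReal.ofReal, ENNReal.coe_inj]
    ext
    rw [NNReal.coe_pow, coe_nnnorm, norm_inv, Complex.norm_real,
      Real.norm_of_nonneg (Real.sqrt_nonneg _), inv_pow, Real.sq_sqrt hL3.le,
      Real.coe_toNNReal _ (by positivity)]
  rw [hc, ENNReal.ofReal_inv_of_pos hL3, ENNReal.ofReal_pow hL.le]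

/-- **The condensate occupation through slices.**
`⟨Ψ, n₀Ψ⟩ = N · L⁻³ ∫_{Ω^{N-1}} |∫_Ω Ψ(x, Y) dx|² dY` (unfolding `occupation` for the constant mode).
[cite: Fournais2020, (1.3)–(1.4)] -/
theorem condensateOccupation_succ {n : ℕ} (hL : 0 < L) (Ψ : Config (n + 1) → ℂ) :
    condensateOccupation (n + 1) L Ψ =
      (n + 1 : ℝ≥0∞) * ((ENNReal.ofReal L ^ 3)⁻¹ *
        ∫⁻ Y in cellN n L, (‖∫ x in cell L, Ψ (Matrix.vecCons x Y)‖₊ : ℝ≥0∞) ^ 2) := by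
  have hL3 : ENNReal.ofReal L ^ 3 ≠ 0 := pow_ne_zero _ (by simpa using hL)
  unfold condensateOccupation occupation
  push_cast
  congr 1
  have hpt : ∀ Y : Config n,
      (‖∫ x, (starRingEnd ℂ) (constantMode L x) *
          (cellN (n + 1) L).indicator Ψ (Matrix.vecCons x Y)‖₊ : ℝ≥0∞) ^ 2 =
        (cellN n L).indicator (fun Y => (ENNReal.ofReal L ^ 3)⁻¹ *
          (‖∫ x in cell L, Ψ (Matrix.vecCons x Y)‖₊ : ℝ≥0∞) ^ 2) Y := by
    intro Y
    by_cases hY : Y ∈ cellN n L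
    · rw [Set.indicator_of_mem hY]
      have hint : (fun x => (starRingEnd ℂ) (constantMode L x) *
          (cellN (n + 1) L).indicator Ψ (Matrix.vecCons x Y)) =
          (cell L).indicator (fun x => ((Real.sqrt (L ^ 3))⁻¹ : ℂ) * Ψ (Matrix.vecCons x Y)) := by
        funext x
        by_cases hx : x ∈ cell L
        · have hmem : Matrix.vecCons x Y ∈ cellN (n + 1) L := by
            intro j
            refine Fin.cases ?_ (fun k => ?_) j
            · simpa using hx
            · simpa using hY k
          simp [constantMode, hx, hmem, Set.indicator_of_mem]
        · simp [constantMode, hx]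
      rw [hint, integral_indicator (measurableSet_cell L), integral_const_mul, nnnorm_mul,
        ENNReal.coe_mul, mul_pow, nnnorm_constantMode_sq hL]
    · rw [Set.indicator_of_notMem hY]
      have hint : (fun x => (starRingEnd ℂ) (constantMode L x) *
          (cellN (n + 1) L).indicator Ψ (Matrix.vecCons x Y)) = fun _ => 0 := by
        funext x
        have hmem : Matrix.vecCons x Y ∉ cellN (n + 1) L := by
          intro h
          exact hY fun k => by simpa using h k.succ
        simp [hmem]
      rw [hint]
      simp
  simp only [hpt]
  rw [lintegral_indicator (measurableSet_cellN n L),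
    lintegral_const_mul' _ _ (ENNReal.inv_ne_top.2 hL3)]

/-- **The `P_Ω`-terms of Lemma 3.3 summed over the particles give `n₀`.**
`∑ᵢ L⁻³ ∫_{Ω^N} L⁻³ |∫_Ω Ψ(…,xᵢ = x,…) dx|² dX = ⟨Ψ, n₀Ψ⟩` (Bose symmetry makes all `N` terms
equal to the `i = 0` one). [cite: Fournais2020, (1.4)] -/
theorem sum_lintegral_sliceMeanSq {n : ℕ} (hL : 0 < L) (Ψ : PeriodicTrialState (n + 1) L) :
    ∑ i : Fin (n + 1), (ENNReal.ofReal L ^ 3)⁻¹ *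
        ∫⁻ X in cellN (n + 1) L, (ENNReal.ofReal L ^ 3)⁻¹ * sliceMeanSq[L, i, Ψ.ψ, X] =
      condensateOccupation (n + 1) L Ψ.ψ := by
  have hL3 : ENNReal.ofReal L ^ 3 ≠ 0 := pow_ne_zero _ (by simpa using hL)
  have hL3' : ENNReal.ofReal L ^ 3 ≠ ⊤ := ENNReal.pow_ne_top ENNReal.ofReal_ne_top
  have hterm : ∀ i : Fin (n + 1),
      (ENNReal.ofReal L ^ 3)⁻¹ *
          ∫⁻ X in cellN (n + 1) L, (ENNReal.ofReal L ^ 3)⁻¹ * sliceMeanSq[L, i, Ψ.ψ, X] =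
        (ENNReal.ofReal L ^ 3)⁻¹ *
          ∫⁻ Y in cellN n L, (‖∫ x in cell L, Ψ.ψ (Matrix.vecCons x Y)‖₊ : ℝ≥0∞) ^ 2 := by
    intro i
    rw [lintegral_const_mul' _ _ (ENNReal.inv_ne_top.2 hL3)]
    have h1 : (fun X => sliceMeanSq[L, i, Ψ.ψ, X]) = fun X => sliceMeanSq[L, 0, Ψ.ψ, X ∘ Equiv.swap 0 i] :=
      funext fun X => sliceMeanSq_eq_zero_comp_swap L i Ψ.symm X
    rw [h1, lintegral_cellN_comp_perm (Equiv.swap 0 i) (fun X => sliceMeanSq[L, 0, Ψ.ψ, X]),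
      lintegral_sliceMeanSq_zero L Ψ.contDiff.continuous, ← mul_assoc, ← mul_assoc,
      mul_assoc _ _ (ENNReal.ofReal L ^ 3), ENNReal.inv_mul_cancel hL3 hL3', mul_one]
  simp only [hterm, Finset.sum_const, Finset.card_univ, Fintype.card_fin, nsmul_eq_mul]
  rw [condensateOccupation_succ hL]
  push_cast
  ring

end Condensate

/-! ### Lemma 3.3 summed over the particles -/

section KineticSum

variable {N : ℕ} {L : ℝ}

/-- Slices of periodic `C¹` states are `C¹`. [folklore] -/
theorem PeriodicTrialState.contDiff_slice (Ψ : PeriodicTrialState N L) (X : Config N) (i : Fin N) :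
    ContDiff ℝ 1 fun x => Ψ.ψ (Function.update X i x) :=
  Ψ.contDiff.comp (contDiff_update 1 X i)

/-- `update X i (x + y) = update X i x + eᵢ ⊗ y`. [folklore] -/
theorem update_add_eq (X : Config N) (i : Fin N) (x y : Space) :
    Function.update X i (x + y) = Function.update X i x + Pi.single i y := by
  funext j
  by_cases hj : j = i
  · subst hj; simp
  · simp [hj]

/-- Slices of periodic states are periodic. [folklore] -/
theorem PeriodicTrialState.periodic_slice (Ψ : PeriodicTrialState N L) (X : Config N) (i : Fin N)
    (x : Space) (k : Fin 3) :
    Ψ.ψ (Function.update X i (x + EuclideanSpace.single k L)) = Ψ.ψ (Function.update X i x) := by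
  rw [update_add_eq, Ψ.periodic]

/-- **Lemma 3.3 summed over the particles** [(3.14), kinetic part]: if the one-body inequality
(3.12) holds for all periodic `C¹` functions, then for a normalised periodic `N`-body state
`∑ᵢ ⟨Ψ, (ℓ⁻³∫_Ω T_u^{(i)} du) Ψ⟩ + 2π²L⁻² N ≤ ⟨Ψ, ∑ᵢ(-Δᵢ) Ψ⟩ + 2π²L⁻² ⟨Ψ, n₀ Ψ⟩`.
[cite: Fournais2020, (3.12), (3.14)] -/
theorem kinetic_bound_of_lemma33 {n : ℕ} (hL : 0 < L) {χ : Space → ℝ} {ℓ s b : ℝ}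
    (h33 : ∀ φ : Space → ℂ, ContDiff ℝ 1 φ →
      (∀ (x : Space) (k : Fin 3), φ (x + EuclideanSpace.single k L) = φ x) →
      (ENNReal.ofReal ℓ ^ 3)⁻¹ * (∫⁻ u in cell L, kinLoc χ ℓ s b u φ) +
          ENNReal.ofReal (2 * Real.pi ^ 2 / L ^ 2) * ∫⁻ x in cell L, (‖φ x‖₊ : ℝ≥0∞) ^ 2 ≤
        (∫⁻ x in cell L, gradSqC φ x) +
          ENNReal.ofReal (2 * Real.pi ^ 2 / L ^ 2) *
            ((ENNReal.ofReal L ^ 3)⁻¹ * (‖∫ x in cell L, φ x‖₊ : ℝ≥0∞) ^ 2))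
    (Ψ : PeriodicTrialState (n + 1) L) :
    (∑ i : Fin (n + 1), (ENNReal.ofReal L ^ 3)⁻¹ *
        ∫⁻ X in cellN (n + 1) L, (ENNReal.ofReal ℓ ^ 3)⁻¹ *
          ∫⁻ u in cell L, kinLoc χ ℓ s b u fun x => Ψ.ψ (Function.update X i x)) +
      ENNReal.ofReal (2 * Real.pi ^ 2 / L ^ 2) * (n + 1 : ℕ) ≤
    (∫⁻ X in cellN (n + 1) L, kineticDensity Ψ.ψ X) +
      ENNReal.ofReal (2 * Real.pi ^ 2 / L ^ 2) * condensateOccupation (n + 1) L Ψ.ψ := by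
  have hL3 : ENNReal.ofReal L ^ 3 ≠ 0 := pow_ne_zero _ (by simpa using hL)
  have hL3' : ENNReal.ofReal L ^ 3 ≠ ⊤ := ENNReal.pow_ne_top ENNReal.ofReal_ne_top
  set g : ℝ≥0∞ := ENNReal.ofReal (2 * Real.pi ^ 2 / L ^ 2) with hg
  have hcont : Continuous Ψ.ψ := Ψ.contDiff.continuous
  have hdiff : Differentiable ℝ Ψ.ψ := Ψ.contDiff.differentiable one_ne_zero
  -- the per-particle inequality, integrated over `Ω^N` and divided by `L³`
  have key : ∀ i : Fin (n + 1),
      (ENNReal.ofReal L ^ 3)⁻¹ *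
          (∫⁻ X in cellN (n + 1) L, (ENNReal.ofReal ℓ ^ 3)⁻¹ *
            ∫⁻ u in cell L, kinLoc χ ℓ s b u fun x => Ψ.ψ (Function.update X i x)) + g ≤
        (ENNReal.ofReal L ^ 3)⁻¹ *
          (∫⁻ X in cellN (n + 1) L, ∫⁻ x in cell L,
            gradSqC (fun y => Ψ.ψ (Function.update X i y)) x) +
          g * ((ENNReal.ofReal L ^ 3)⁻¹ *
            ∫⁻ X in cellN (n + 1) L, (ENNReal.ofReal L ^ 3)⁻¹ * sliceMeanSq[L, i, Ψ.ψ, X]) := by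
    intro i
    have hint := lintegral_mono (μ := volume.restrict (cellN (n + 1) L)) fun X =>
      h33 _ (Ψ.contDiff_slice X i) (Ψ.periodic_slice X i)
    -- split the two sides
    have hlhs : (∫⁻ X in cellN (n + 1) L, (ENNReal.ofReal ℓ ^ 3)⁻¹ *
          ∫⁻ u in cell L, kinLoc χ ℓ s b u fun x => Ψ.ψ (Function.update X i x)) +
        g * ENNReal.ofReal L ^ 3 ≤
        ∫⁻ X in cellN (n + 1) L, (ENNReal.ofReal ℓ ^ 3)⁻¹ *
            (∫⁻ u in cell L, kinLoc χ ℓ s b u fun x => Ψ.ψ (Function.update X i x)) +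
          g * ∫⁻ x in cell L, (‖Ψ.ψ (Function.update X i x)‖₊ : ℝ≥0∞) ^ 2 := by
      refine le_trans (le_of_eq ?_) (le_lintegral_add _ _)
      rw [lintegral_const_mul' g _ ENNReal.ofReal_ne_top,
        lintegral_normSq_slice i hcont.measurable, Ψ.norm_eq, mul_one]
    have hrhs : (∫⁻ X in cellN (n + 1) L, (∫⁻ x in cell L,
          gradSqC (fun y => Ψ.ψ (Function.update X i y)) x) +
          g * ((ENNReal.ofReal L ^ 3)⁻¹ * sliceMeanSq[L, i, Ψ.ψ, X])) =
        (∫⁻ X in cellN (n + 1) L, ∫⁻ x in cell L,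
            gradSqC (fun y => Ψ.ψ (Function.update X i y)) x) +
          g * ∫⁻ X in cellN (n + 1) L, (ENNReal.ofReal L ^ 3)⁻¹ * sliceMeanSq[L, i, Ψ.ψ, X] := by
      rw [lintegral_add_right _ (((measurable_sliceMeanSq L i hcont).const_mul _).const_mul g),
        lintegral_const_mul' g _ ENNReal.ofReal_ne_top]
    have h3 := (hlhs.trans hint).trans_eq hrhs
    -- divide by L³
    have h4 : (ENNReal.ofReal L ^ 3)⁻¹ * ((∫⁻ X in cellN (n + 1) L, (ENNReal.ofReal ℓ ^ 3)⁻¹ *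
          ∫⁻ u in cell L, kinLoc χ ℓ s b u fun x => Ψ.ψ (Function.update X i x)) +
        g * ENNReal.ofReal L ^ 3) ≤ (ENNReal.ofReal L ^ 3)⁻¹ *
        ((∫⁻ X in cellN (n + 1) L, ∫⁻ x in cell L,
            gradSqC (fun y => Ψ.ψ (Function.update X i y)) x) +
          g * ∫⁻ X in cellN (n + 1) L, (ENNReal.ofReal L ^ 3)⁻¹ * sliceMeanSq[L, i, Ψ.ψ, X]) := by
      gcongr
    rw [mul_add, mul_add, ← mul_assoc _ g, mul_comm _ g, mul_assoc g, ENNReal.inv_mul_cancel hL3 hL3',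
      mul_one] at h4
    calc _ ≤ _ := h4
      _ = _ := by rw [← mul_assoc _ g, mul_comm _ g, mul_assoc g]
  have hsum := Finset.sum_le_sum fun i (_ : i ∈ Finset.univ) => key i
  have hR : ∑ i : Fin (n + 1), g * ((ENNReal.ofReal L ^ 3)⁻¹ *
      ∫⁻ X in cellN (n + 1) L, (ENNReal.ofReal L ^ 3)⁻¹ * sliceMeanSq[L, i, Ψ.ψ, X]) =
      g * condensateOccupation (n + 1) L Ψ.ψ := by
    rw [← Finset.mul_sum, sum_lintegral_sliceMeanSq hL Ψ]
  rw [Finset.sum_add_distrib, Finset.sum_add_distrib, Finset.sum_const, Finset.card_univ,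
    Fintype.card_fin, nsmul_eq_mul, mul_comm _ g, hR, sum_lintegral_gradSqC_slice hL hdiff] at hsum
  exact hsum

end KineticSum

/-! ### Measurability of the localised objects (for Tonelli in `u ↔ X`) -/

section Measurability

variable {N : ℕ}

/-- `(u, X) ↦ w_u^per(xᵢ, xⱼ)` is measurable. [folklore] -/
theorem measurable_pairLocPer₂ {v : ℝ → ℝ≥0∞} (hv : Measurable v) {χ : Space → ℝ}
    (hχ : IsLocalizationFunction χ) (ℓ L : ℝ) (i j : Fin N) :
    Measurable fun q : Space × Config N => pairLocPer v χ ℓ L q.1 (q.2 i) (q.2 j) := by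
  have hi : Measurable fun q : Space × Config N => q.2 i := (measurable_pi_apply i).comp measurable_snd
  have hj : Measurable fun q : Space × Config N => q.2 j := (measurable_pi_apply j).comp measurable_snd
  have h1 := (measurable_locFunPer₂ hχ ℓ L).comp (measurable_fst.prodMk hi)
  have h2 := (measurable_locFunPer₂ hχ ℓ L).comp (measurable_fst.prodMk hj)
  have h3 := (measurable_bigWPer hv hχ ℓ L).comp (hi.sub hj)
  unfold pairLocPer
  exact (h1.mul h3).mul h2

/-- `(u, X) ↦ ∑_{i<j} w_u^per(xᵢ, xⱼ)` is measurable. [folklore] -/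
theorem measurable_repLocN₂ {v : ℝ → ℝ≥0∞} (hv : Measurable v) {χ : Space → ℝ}
    (hχ : IsLocalizationFunction χ) (ℓ L : ℝ) :
    Measurable fun q : Space × Config N => repLocN v χ ℓ L q.1 q.2 := by
  unfold repLocN
  exact Finset.measurable_sum _ fun i _ =>
    Finset.measurable_sum _ fun j _ => measurable_pairLocPer₂ hv hχ ℓ L i j

/-- `(u, X) ↦ ρ_μ ∑ᵢ ∫_Ω w_{1,u}^per(xᵢ, y) dy` is measurable. [folklore] -/
theorem measurable_attrLocN₂ {v : ℝ → ℝ≥0∞} (hv : Measurable v) {ω : Space → ℝ} (hω : Measurable ω)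
    {χ : Space → ℝ} (hχ : IsLocalizationFunction χ) (ℓ L ρμ : ℝ) :
    Measurable fun q : Space × Config N => attrLocN v ω χ ℓ L ρμ q.1 q.2 := by
  have hterm : ∀ i : Fin N, Measurable fun q : Space × Config N =>
      ∫⁻ y in cell L, pairLoc₁Per v ω χ ℓ L q.1 (q.2 i) y := by
    intro i
    have hu : Measurable fun r : (Space × Config N) × Space => r.1.1 :=
      measurable_fst.comp measurable_fst
    have hi : Measurable fun r : (Space × Config N) × Space => r.1.2 i :=
      (measurable_pi_apply i).comp (measurable_snd.comp measurable_fst)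
    have h1 := (measurable_locFunPer₂ hχ ℓ L).comp (hu.prodMk hi)
    have h2 := (measurable_locFunPer₂ hχ ℓ L).comp (hu.prodMk measurable_snd)
    have h3 := (measurable_bigW₁Per hv hω hχ ℓ L).comp (hi.sub measurable_snd)
    have h123 : Measurable fun r : (Space × Config N) × Space =>
        locFunPer χ ℓ L r.1.1 (r.1.2 i) * bigW₁Per v ω χ ℓ L (r.1.2 i - r.2) *
          locFunPer χ ℓ L r.1.1 r.2 := (h1.mul h3).mul h2
    have h := h123.lintegral_prod_right' (ν := volume.restrict (cell L))
    unfold pairLoc₁Per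
    exact h
  unfold attrLocN
  exact (Finset.measurable_sum _ fun i _ => hterm i).const_mul _

/-- The set `{(u, x) | x ∈ Λ(u)}` is measurable. [folklore] -/
theorem measurableSet_slidingBox₂ (ℓ : ℝ) :
    MeasurableSet {q : Space × Space | q.2 ∈ slidingBox ℓ q.1} := by
  have : {q : Space × Space | q.2 ∈ slidingBox ℓ q.1} =
      ⋂ k : Fin 3, (fun q : Space × Space => q.2 k - q.1 k) ⁻¹' Set.Icc (-ℓ / 2) (ℓ / 2) := by
    ext q; simp [slidingBox]
  rw [this]
  exact MeasurableSet.iInter fun k => measurableSet_Icc.preimage (by fun_prop)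

/-- Joint (strong) measurability of `((u, X), x) ↦ (Q_u Ψ(X; ·ᵢ))(x)`. [folklore] -/
theorem stronglyMeasurable_projQ_slice (ℓ : ℝ) (i : Fin N) {Ψ : Config N → ℂ} (hΨ : Continuous Ψ) :
    StronglyMeasurable fun r : (Space × Config N) × Space =>
      projQ ℓ r.1.1 (fun x => Ψ (Function.update r.1.2 i x)) r.2 := by
  set S : Set ((Space × Config N) × Space) := {r | r.2 ∈ slidingBox ℓ r.1.1} with hSdef
  have hsl : Continuous fun r : (Space × Config N) × Space => Ψ (Function.update r.1.2 i r.2) :=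
    hΨ.comp ((continuous_snd.comp continuous_fst).update i continuous_snd)
  have hp : Measurable fun r : (Space × Config N) × Space => (r.1.1, r.2) := by fun_prop
  have hS : MeasurableSet S := hp (measurableSet_slidingBox₂ ℓ)
  -- the box average `(u,X) ↦ ∫_{Λ(u)} Ψ(update X i y) dy`
  have hM : StronglyMeasurable fun q : Space × Config N =>
      ∫ y in slidingBox ℓ q.1, Ψ (Function.update q.2 i y) := by
    have h := (hsl.stronglyMeasurable.indicator hS).integral_prod_right'
      (ν := (volume : Measure Space))
    have hfun : (fun q : Space × Config N => ∫ y in slidingBox ℓ q.1, Ψ (Function.update q.2 i y)) =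
        fun q => ∫ y, S.indicator (fun r => Ψ (Function.update r.1.2 i r.2)) (q, y) := by
      funext q
      rw [← integral_indicator (measurableSet_slidingBox ℓ q.1)]
      rfl
    rw [hfun]
    exact h
  have hfun : (fun r : (Space × Config N) × Space =>
      projQ ℓ r.1.1 (fun x => Ψ (Function.update r.1.2 i x)) r.2) =
      S.indicator fun r => Ψ (Function.update r.1.2 i r.2) -
        ((ℓ ^ 3)⁻¹ : ℝ) • ∫ y in slidingBox ℓ r.1.1, Ψ (Function.update r.1.2 i y) := by
    funext r
    rfl
  rw [hfun]
  exact (hsl.stronglyMeasurable.sub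
    ((hM.comp_measurable measurable_fst).const_smul ((ℓ ^ 3)⁻¹ : ℝ))).indicator hS

/-- Joint measurability of `((u, X), x) ↦ χ_u(x) (Q_u Ψ(X; ·ᵢ))(x)`, the function whose Fourier
transform enters `T_u`. [folklore] -/
theorem stronglyMeasurable_locFun_mul_projQ_slice {χ : Space → ℝ} (hχ : Continuous χ) (ℓ : ℝ)
    (i : Fin N) {Ψ : Config N → ℂ} (hΨ : Continuous Ψ) :
    StronglyMeasurable fun r : (Space × Config N) × Space =>
      (locFun χ ℓ r.1.1 r.2 : ℂ) * projQ ℓ r.1.1 (fun x => Ψ (Function.update r.1.2 i x)) r.2 := by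
  refine StronglyMeasurable.mul ?_ (stronglyMeasurable_projQ_slice ℓ i hΨ)
  refine (Complex.continuous_ofReal.comp ?_).stronglyMeasurable
  unfold locFun
  fun_prop

/-- Joint measurability of `((u, X), p) ↦ 𝓕(χ_u Q_u Ψ(X; ·ᵢ))(p)`. [folklore] -/
theorem stronglyMeasurable_fourier_slice {χ : Space → ℝ} (hχ : Continuous χ) (ℓ : ℝ)
    (i : Fin N) {Ψ : Config N → ℂ} (hΨ : Continuous Ψ) :
    StronglyMeasurable fun r : (Space × Config N) × Space =>
      𝓕 (fun x => (locFun χ ℓ r.1.1 x : ℂ) *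
        projQ ℓ r.1.1 (fun x => Ψ (Function.update r.1.2 i x)) x) r.2 := by
  have hfun : (fun r : (Space × Config N) × Space =>
      𝓕 (fun x => (locFun χ ℓ r.1.1 x : ℂ) *
        projQ ℓ r.1.1 (fun x => Ψ (Function.update r.1.2 i x)) x) r.2) =
      fun r => ∫ y : Space, Complex.exp (↑(-2 * Real.pi * inner ℝ y r.2) * Complex.I) •
        ((locFun χ ℓ r.1.1 y : ℂ) * projQ ℓ r.1.1 (fun x => Ψ (Function.update r.1.2 i x)) y) :=
    funext fun r => Real.fourier_eq' _ _
  rw [hfun]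
  have hK : Continuous fun r : ((Space × Config N) × Space) × Space =>
      Complex.exp (↑(-2 * Real.pi * inner ℝ r.2 r.1.2) * Complex.I) := by
    fun_prop
  have hp : Measurable fun r : ((Space × Config N) × Space) × Space => (r.1.1, r.2) := by
    fun_prop
  have hF := (stronglyMeasurable_locFun_mul_projQ_slice hχ ℓ i hΨ).comp_measurable hp
  have hprod := hK.stronglyMeasurable.smul hF
  exact hprod.integral_prod_right' (ν := (volume : Measure Space))

/-- **Joint measurability of `(u, X) ↦ ⟨Ψ(X; ·ᵢ), T_u Ψ(X; ·ᵢ)⟩`.** [folklore] -/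
theorem measurable_kinLoc_slice {χ : Space → ℝ} (hχ : Continuous χ) (ℓ s b : ℝ) (i : Fin N)
    {Ψ : Config N → ℂ} (hΨ : Continuous Ψ) :
    Measurable fun q : Space × Config N =>
      kinLoc χ ℓ s b q.1 fun x => Ψ (Function.update q.2 i x) := by
  unfold kinLoc
  refine Measurable.add ?_ (Measurable.const_mul ?_ _)
  · refine Measurable.lintegral_prod_right' (f := fun r : (Space × Config N) × Space =>
      ENNReal.ofReal (4 * Real.pi ^ 2 * ‖r.2‖ ^ 2 - (s * ℓ)⁻¹ ^ 2) *
        (‖𝓕 (fun x => (locFun χ ℓ r.1.1 x : ℂ) *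
          projQ ℓ r.1.1 (fun x => Ψ (Function.update r.1.2 i x)) x) r.2‖₊ : ℝ≥0∞) ^ 2) ?_
    refine Measurable.mul (ENNReal.measurable_ofReal.comp (by fun_prop)) ?_
    exact ((stronglyMeasurable_fourier_slice hχ ℓ i hΨ).measurable.nnnorm.coe_nnreal_ennreal).pow_const _
  · refine Measurable.lintegral_prod_right' (f := fun r : (Space × Config N) × Space =>
      (‖projQ ℓ r.1.1 (fun x => Ψ (Function.update r.1.2 i x)) r.2‖₊ : ℝ≥0∞) ^ 2) ?_
    exact ((stronglyMeasurable_projQ_slice ℓ i hΨ).measurable.nnnorm.coe_nnreal_ennreal).pow_const _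

end Measurability

/-! ### Theorem 3.1 from its four ingredients [(3.14)–(3.17)] -/

section Assembly

open scoped Convolution Topology

/-- `χ * χ` is continuous and equals `∫ χ² = 1` at the origin, hence is positive near the origin —
the well-definedness of `W = v/(χ*χ)(x/ℓ)` for `R/ℓ` small.
[cite: BrietzkeFournaisSolovej2020, (5.8)–(5.9)] -/
theorem exists_selfConv_pos {χ : Space → ℝ} (hχ : IsLocalizationFunction χ) :
    ∃ D : ℝ, 0 < D ∧ ∀ y : Space, ‖y‖ ≤ D → 0 < selfConv χ y := by
  have hev : ∀ᶠ y in 𝓝 (0 : Space), 0 < selfConv χ y := by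
    have ht : Filter.Tendsto (selfConv χ) (𝓝 0) (𝓝 1) := by
      have h := hχ.continuous_selfConv.continuousAt (x := (0 : Space))
      rwa [ContinuousAt, hχ.selfConv_zero] at h
    exact ht.eventually_const_lt zero_lt_one
  obtain ⟨ε, hε, hball⟩ := Metric.eventually_nhds_iff.mp hev
  refine ⟨ε / 2, by positivity, fun y hy => hball ?_⟩
  rw [dist_zero_right]
  linarith

variable {N : ℕ} {L : ℝ}

/-- `X ↦ |Ψ(X)|²` is measurable and finite for a `C¹` state. [folklore] -/
theorem PeriodicTrialState.measurable_normSq (Ψ : PeriodicTrialState N L) :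
    Measurable fun X => (‖Ψ.ψ X‖₊ : ℝ≥0∞) ^ 2 :=
  (Ψ.contDiff.continuous.measurable.nnnorm.coe_nnreal_ennreal).pow_const _

/-- **(3.14), kinetic part, order of integration.** `ℓ⁻³ ∫_Ω ∑ᵢ⟨Ψ,T_u^{(i)}Ψ⟩ du =
∑ᵢ L⁻³∫_{Ω^N} ℓ⁻³∫_Ω ⟨Ψ(X;·ᵢ), T_u Ψ(X;·ᵢ)⟩ du dX` (Tonelli). [cite: Fournais2020, (3.14)] -/
theorem lintegral_kinLocN_swap {χ : Space → ℝ} (hχ : Continuous χ) {ℓ : ℝ} (hℓ : 0 < ℓ)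
    (hL : 0 < L) (s b : ℝ) (Ψ : PeriodicTrialState N L) :
    (ENNReal.ofReal ℓ ^ 3)⁻¹ * ∫⁻ u in cell L, kinLocN χ ℓ s b u L Ψ.ψ =
      ∑ i : Fin N, (ENNReal.ofReal L ^ 3)⁻¹ *
        ∫⁻ X in cellN N L, (ENNReal.ofReal ℓ ^ 3)⁻¹ *
          ∫⁻ u in cell L, kinLoc χ ℓ s b u fun x => Ψ.ψ (Function.update X i x) := by
  have hL3 : (ENNReal.ofReal L ^ 3)⁻¹ ≠ ⊤ :=
    ENNReal.inv_ne_top.2 (pow_ne_zero _ (by simpa using hL))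
  have hℓ3 : (ENNReal.ofReal ℓ ^ 3)⁻¹ ≠ ⊤ :=
    ENNReal.inv_ne_top.2 (pow_ne_zero _ (by simpa using hℓ))
  have hcont := Ψ.contDiff.continuous
  have hmeas : ∀ i : Fin N, Measurable fun u : Space => (ENNReal.ofReal L ^ 3)⁻¹ *
      ∫⁻ X in cellN N L, kinLoc χ ℓ s b u fun x => Ψ.ψ (Function.update X i x) := fun i =>
    ((measurable_kinLoc_slice hχ ℓ s b i hcont).lintegral_prod_right'
      (ν := volume.restrict (cellN N L))).const_mul _
  unfold kinLocN
  rw [lintegral_finsetSum _ fun i _ => hmeas i, Finset.mul_sum]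
  refine Finset.sum_congr rfl fun i _ => ?_
  rw [lintegral_const_mul' _ _ hL3,
    lintegral_lintegral_swap ((measurable_kinLoc_slice hχ ℓ s b i hcont).aemeasurable),
    mul_left_comm, ← lintegral_const_mul' _ _ hℓ3]

/-- **(3.14), repulsive part.** With Lemma 3.2 (pair part) inserted,
`⟨Ψ, ∑_{i<j}v^perΨ⟩ = ℓ⁻³∫_Ω ⟨Ψ, ∑_{i<j} w_u^per Ψ⟩ du` (Tonelli). [cite: Fournais2020, (3.10), (3.14)] -/
theorem lintegral_rep_swap {v : ℝ → ℝ≥0∞} (hv : Measurable v) {χ : Space → ℝ}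
    (hχ : IsLocalizationFunction χ)
    {ℓ : ℝ} (hℓ : 0 < ℓ) (Ψ : PeriodicTrialState N L)
    (h32a : ∀ X : Config N, periodicInteraction v L X =
      (ENNReal.ofReal ℓ ^ 3)⁻¹ * ∫⁻ u in cell L, repLocN v χ ℓ L u X) :
    ∫⁻ X in cellN N L, periodicInteraction v L X * (‖Ψ.ψ X‖₊ : ℝ≥0∞) ^ 2 =
      (ENNReal.ofReal ℓ ^ 3)⁻¹ * ∫⁻ u in cell L, ∫⁻ X in cellN N L,
        repLocN v χ ℓ L u X * (‖Ψ.ψ X‖₊ : ℝ≥0∞) ^ 2 := by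
  have hℓ3 : (ENNReal.ofReal ℓ ^ 3)⁻¹ ≠ ⊤ :=
    ENNReal.inv_ne_top.2 (pow_ne_zero _ (by simpa using hℓ))
  have hpt : ∀ X : Config N, periodicInteraction v L X * (‖Ψ.ψ X‖₊ : ℝ≥0∞) ^ 2 =
      (ENNReal.ofReal ℓ ^ 3)⁻¹ *
        ∫⁻ u in cell L, repLocN v χ ℓ L u X * (‖Ψ.ψ X‖₊ : ℝ≥0∞) ^ 2 := by
    intro X
    rw [h32a X, mul_assoc, lintegral_mul_const' _ _ (ENNReal.pow_ne_top ENNReal.coe_ne_top)]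
  simp only [hpt]
  have hm : AEMeasurable (Function.uncurry fun (X : Config N) (u : Space) =>
      repLocN v χ ℓ L u X * (‖Ψ.ψ X‖₊ : ℝ≥0∞) ^ 2)
      ((volume.restrict (cellN N L)).prod (volume.restrict (cell L))) :=
    (((measurable_repLocN₂ hv hχ ℓ L).comp measurable_swap).mul
      (Ψ.measurable_normSq.comp measurable_fst)).aemeasurable
  rw [lintegral_const_mul' _ _ hℓ3, lintegral_lintegral_swap hm]

/-- **(3.14), attractive part.** With Lemma 3.2 (one-body part) and `∫ g = 8πa` (A.5) inserted,
`ℓ⁻³ ∫_Ω ⟨Ψ, ρ_μ∑ᵢ∫_Ω w^per_{1,u}(xᵢ,y)dy Ψ⟩ du = ρ_μ ∑ᵢ ∫ g = 8πaρ_μN` (Tonelli, translation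
invariance, normalisation). [cite: Fournais2020, (3.1), (3.10), (A.5)] -/
theorem lintegral_attr_eq {v : ℝ → ℝ≥0∞} (hv : Measurable v) (hint : (∫⁻ x : Space, v ‖x‖) ≠ ⊤)
    {ω : Space → ℝ} (hω : IsScatteringSolution v ω) {χ : Space → ℝ} (hχ : IsLocalizationFunction χ)
    {ℓ : ℝ} (hℓ : 0 < ℓ) {ρμ : ℝ} (hρμ : 0 ≤ ρμ) (Ψ : PeriodicTrialState N L)
    (h32b : ∀ X : Config N, ENNReal.ofReal ρμ *
        ∑ i : Fin N, ∫⁻ y : Space, v ‖X i - y‖ * ENNReal.ofReal (1 - ω (X i - y)) =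
      (ENNReal.ofReal ℓ ^ 3)⁻¹ * ∫⁻ u in cell L, attrLocN v ω χ ℓ L ρμ u X) :
    (ENNReal.ofReal ℓ ^ 3)⁻¹ * ∫⁻ u in cell L, ∫⁻ X in cellN N L,
        attrLocN v ω χ ℓ L ρμ u X * (‖Ψ.ψ X‖₊ : ℝ≥0∞) ^ 2 =
      ENNReal.ofReal (8 * Real.pi * (scatteringLength v).toReal * ρμ * N) := by
  have hℓ3 : (ENNReal.ofReal ℓ ^ 3)⁻¹ ≠ ⊤ :=
    ENNReal.inv_ne_top.2 (pow_ne_zero _ (by simpa using hℓ))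
  have hsL : scatteringLength v ≠ ⊤ := by
    refine scatteringLength_ne_top ?_
    rw [lintegral_const_mul' _ _ (ENNReal.inv_ne_top.2 two_ne_zero)]
    exact ENNReal.mul_ne_top (ENNReal.inv_ne_top.2 two_ne_zero) hint
  -- translation invariance and (A.5)
  have hG : ∀ x : Space, ∫⁻ y : Space, v ‖x - y‖ * ENNReal.ofReal (1 - ω (x - y)) =
      ENNReal.ofReal (8 * Real.pi) * scatteringLength v := fun x =>
    (lintegral_sub_left_eq_self (μ := (volume : Measure Space))
      (fun y => v ‖y‖ * ENNReal.ofReal (1 - ω y)) x).trans hω.lintegral_g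
  have hA : ∀ X : Config N, (ENNReal.ofReal ℓ ^ 3)⁻¹ * ∫⁻ u in cell L, attrLocN v ω χ ℓ L ρμ u X =
      ENNReal.ofReal (8 * Real.pi * (scatteringLength v).toReal * ρμ * N) := by
    intro X
    rw [← h32b X]
    simp only [hG, Finset.sum_const, Finset.card_univ, Fintype.card_fin, nsmul_eq_mul]
    have hsLeq : scatteringLength v = ENNReal.ofReal (scatteringLength v).toReal :=
      (ENNReal.ofReal_toReal hsL).symm
    conv_lhs => rw [hsLeq]
    rw [← ENNReal.ofReal_natCast, ← ENNReal.ofReal_mul (by positivity),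
      ← ENNReal.ofReal_mul (by positivity), ← ENNReal.ofReal_mul hρμ]
    congr 1
    ring
  have hm : AEMeasurable (Function.uncurry fun (u : Space) (X : Config N) =>
      attrLocN v ω χ ℓ L ρμ u X * (‖Ψ.ψ X‖₊ : ℝ≥0∞) ^ 2)
      ((volume.restrict (cell L)).prod (volume.restrict (cellN N L))) :=
    ((measurable_attrLocN₂ hv hω.measurable hχ ℓ L ρμ).mul
      (Ψ.measurable_normSq.comp measurable_snd)).aemeasurable
  rw [lintegral_lintegral_swap hm]
  have hpt : ∀ X : Config N, ∫⁻ u in cell L, attrLocN v ω χ ℓ L ρμ u X * (‖Ψ.ψ X‖₊ : ℝ≥0∞) ^ 2 =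
      (∫⁻ u in cell L, attrLocN v ω χ ℓ L ρμ u X) * (‖Ψ.ψ X‖₊ : ℝ≥0∞) ^ 2 := fun X =>
    lintegral_mul_const' _ _ (ENNReal.pow_ne_top ENNReal.coe_ne_top)
  simp only [hpt]
  rw [← lintegral_const_mul' _ _ hℓ3]
  simp only [← mul_assoc, hA]
  rw [lintegral_const_mul' _ _ ENNReal.ofReal_ne_top, Ψ.norm_eq, mul_one]

/-- **(3.17) integrated over the sliding parameter.** [cite: Fournais2020, (3.14), (3.17)] -/
theorem lintegral_e317 (ℓ : ℝ) {A K R : Space → ℝ≥0∞}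
    (hK : Measurable K) (hR : Measurable R) {C : ℝ≥0∞}
    (H : ∀ u ∈ cell L, A u ≤ K u + R u + C) :
    (ENNReal.ofReal ℓ ^ 3)⁻¹ * ∫⁻ u in cell L, A u ≤
      (ENNReal.ofReal ℓ ^ 3)⁻¹ * (∫⁻ u in cell L, K u) +
        (ENNReal.ofReal ℓ ^ 3)⁻¹ * (∫⁻ u in cell L, R u) +
        (ENNReal.ofReal ℓ ^ 3)⁻¹ * (C * ENNReal.ofReal L ^ 3) := by
  have h1 : ∫⁻ u in cell L, A u ≤ ∫⁻ u in cell L, (K u + R u + C) :=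
    setLIntegral_mono' (measurableSet_cell L) H
  have hKR : Measurable fun u => K u + R u := hK.add hR
  rw [lintegral_add_left hKR, lintegral_add_left hK, setLIntegral_const, volume_cell] at h1
  calc (ENNReal.ofReal ℓ ^ 3)⁻¹ * ∫⁻ u in cell L, A u
      ≤ (ENNReal.ofReal ℓ ^ 3)⁻¹ * ((∫⁻ u in cell L, K u) + (∫⁻ u in cell L, R u) +
          C * ENNReal.ofReal L ^ 3) := by gcongr
    _ = _ := by rw [mul_add, mul_add]

/-- **Fournais 2020, Theorem 3.1 from its printed ingredients** [proof of Thm. 3.1, pp. 14–16]: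
the existence of the scattering solution (App. A), the sliding-localisation identities of
Lemma 3.2 and the inequality of Lemma 3.3, and the small-box bound (3.17) (Thm. 2.1 transported to
the boxes `Λ(u)`) imply Thm. 3.1 (3.2) by (3.14): `H_{ρ_μ,N} ≥ ℓ⁻³∫_Ω (∑ᵢT_u^{(i)} + W_{u,N}) du
≥ ℓ⁻³ · L³ · (-4πρ_μ²aℓ³(1 + C₀(ρ_μa³)^{1/2}))`.
[cite: Fournais2020, Thm. 3.1, (3.14)–(3.17)] -/
theorem Fournais2020_thm31_of_localization (hSS : LSSY2005_scatteringSolution)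
    (h33 : Fournais2020_lemma33) (h317 : Fournais2020_eq317) :
    Fournais2020_thm31 := by
  intro v hv hint ha
  obtain ⟨hvmeas, R₀, hR₀⟩ := hv
  obtain ⟨ω, hω⟩ := hSS v ⟨hvmeas, R₀, hR₀⟩ hint
  obtain ⟨χ, hχ⟩ := exists_isLocalizationFunction
  have hχc : Continuous χ := hχ.contDiff.continuous
  obtain ⟨b, s₀, hb, hs₀, H33⟩ := h33 χ hχ
  obtain ⟨K₀, hK₀, H317⟩ := h317 v ⟨hvmeas, R₀, hR₀⟩ hint ha ω hω χ hχ b s₀ hb hs₀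
  obtain ⟨C₀, c₀, hC₀, hc₀, H⟩ := H317 K₀ le_rfl
  obtain ⟨D, hD, hDpos⟩ := exists_selfConv_pos hχ
  have ha0 : 0 < (scatteringLength v).toReal := scatteringLength_toReal_pos hint ha
  set R : ℝ := max R₀ 0 + 1 with hRdef
  have hRpos : 0 < R := by have := le_max_right R₀ 0; linarith
  have hR : ∀ r, R ≤ r → v r = 0 := fun r hr => hR₀ r (by have := le_max_left R₀ 0; linarith)
  set m : ℝ := min D 1 with hm
  have hm0 : 0 < m := lt_min hD one_pos
  refine ⟨K₀, C₀, min c₀ ((m / (R * K₀)) ^ 2 * (scatteringLength v).toReal ^ 2), hK₀, hC₀,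
    lt_min hc₀ (by positivity), ?_⟩
  intro ρμ N L hρμ hL a hρc hℓL Ψ
  -- the small-box side and its constraints `R ≤ ℓ`, `R/ℓ ≤ D`
  set ℓ : ℝ := boxLength K₀ ρμ a with hℓdef
  have hsq : 0 < Real.sqrt (ρμ * a) := Real.sqrt_pos.2 (by positivity)
  have hℓ0 : 0 < ℓ := by rw [hℓdef, boxLength]; positivity
  have hℓL' : 2 * ℓ < L := hℓL
  have hRℓm : R / ℓ ≤ m := by
    have h1 : ρμ * a ≤ (m / (R * K₀)) ^ 2 := by
      have h2 : ρμ * a ^ 3 ≤ (m / (R * K₀)) ^ 2 * a ^ 2 := hρc.trans (min_le_right _ _)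
      have h3 : ρμ * a * a ^ 2 ≤ (m / (R * K₀)) ^ 2 * a ^ 2 := by nlinarith
      exact le_of_mul_le_mul_right h3 (by positivity)
    have h4 : Real.sqrt (ρμ * a) ≤ m / (R * K₀) := by
      rw [← Real.sqrt_sq (by positivity : 0 ≤ m / (R * K₀))]
      exact Real.sqrt_le_sqrt h1
    rw [hℓdef, boxLength, div_inv_eq_mul]
    calc R * (K₀ * Real.sqrt (ρμ * a)) = (R * K₀) * Real.sqrt (ρμ * a) := by ring
      _ ≤ (R * K₀) * (m / (R * K₀)) := by gcongr
      _ = m := by field_simp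
  have hRℓ : R ≤ ℓ := by
    have : R / ℓ ≤ 1 := hRℓm.trans (min_le_right _ _)
    rwa [div_le_one hℓ0] at this
  have hpos : ∀ y : Space, ‖y‖ ≤ R / ℓ → 0 < selfConv χ y := fun y hy =>
    hDpos y (hy.trans (hRℓm.trans (min_le_left _ _)))
  -- the four ingredients at these parameters
  have H32 := Fournais2020_lemma32_holds v R hvmeas hR ω hω.measurable χ hχ ℓ L hℓ0 hRℓ hℓL' hpos N
  have H33' := H33 s₀ hs₀ le_rfl ℓ L hℓ0 hℓL'
  have H' := H ρμ N L hρμ hL (hρc.trans (min_le_left _ _)) hℓL'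
  have hℓfold : boxLength K₀ ρμ (scatteringLength v).toReal = ℓ := rfl
  simp only [hℓfold] at H'
  -- `N = 0` is trivial
  cases N with
  | zero => simp
  | succ n =>
  -- notation
  have hL3 : ENNReal.ofReal L ^ 3 ≠ 0 := pow_ne_zero _ (by simpa using hL)
  have hL3' : ENNReal.ofReal L ^ 3 ≠ ⊤ := ENNReal.pow_ne_top ENNReal.ofReal_ne_top
  have hℓ3 : ENNReal.ofReal ℓ ^ 3 ≠ 0 := pow_ne_zero _ (by simpa using hℓ0)
  have hℓ3' : ENNReal.ofReal ℓ ^ 3 ≠ ⊤ := ENNReal.pow_ne_top ENNReal.ofReal_ne_top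
  set g : ℝ≥0∞ := ENNReal.ofReal (2 * Real.pi ^ 2 / L ^ 2) with hg
  set Cst : ℝ≥0∞ := ENNReal.ofReal
    (4 * Real.pi * ρμ ^ 2 * a * ℓ ^ 3 * (1 + C₀ * (ρμ * a ^ 3) ^ (1 / 2 : ℝ))) with hCst
  -- Step A: Lemma 3.3 summed over the particles
  have hA := kinetic_bound_of_lemma33 hL H33' Ψ
  -- Step B: order of integration in the kinetic term
  have hB := lintegral_kinLocN_swap hχc hℓ0 hL s₀ b Ψ
  -- Step C: repulsive part
  have hC := lintegral_rep_swap hvmeas hχ hℓ0 Ψ fun X => (H32 X).1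
  -- Step D: attractive part
  have hD := lintegral_attr_eq hvmeas hint hω hχ hℓ0 hρμ.le Ψ fun X => (H32 X).2 ρμ hρμ.le
  -- Step E: (3.17) integrated over `u ∈ Ω`
  have hmeasK : Measurable fun u : Space => kinLocN χ ℓ s₀ b u L Ψ.ψ := by
    unfold kinLocN
    refine Finset.measurable_sum _ fun i _ => ?_
    exact ((measurable_kinLoc_slice hχc ℓ s₀ b i Ψ.contDiff.continuous).lintegral_prod_right'
      (ν := volume.restrict (cellN (n + 1) L))).const_mul _
  have hmeasR : Measurable fun u : Space => ∫⁻ X in cellN (n + 1) L,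
      repLocN v χ ℓ L u X * (‖Ψ.ψ X‖₊ : ℝ≥0∞) ^ 2 :=
    ((measurable_repLocN₂ hvmeas hχ ℓ L).mul
      (Ψ.measurable_normSq.comp measurable_snd)).lintegral_prod_right'
      (ν := volume.restrict (cellN (n + 1) L))
  have hE := lintegral_e317 ℓ
    (A := fun u => ∫⁻ X in cellN (n + 1) L, attrLocN v ω χ ℓ L ρμ u X * (‖Ψ.ψ X‖₊ : ℝ≥0∞) ^ 2)
    hmeasK hmeasR (C := Cst) fun u hu => H' u hu Ψ
  -- the energy splits as kinetic + potential
  have hEn : periodicEnergy v Ψ = (∫⁻ X in cellN (n + 1) L, kineticDensity Ψ.ψ X) +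
      ∫⁻ X in cellN (n + 1) L, periodicInteraction v L X * (‖Ψ.ψ X‖₊ : ℝ≥0∞) ^ 2 := by
    unfold periodicEnergy
    rw [lintegral_add_left]
    have : kineticDensity Ψ.ψ = fun X => ∑ i, gradSqAt[i, Ψ.ψ, X] := rfl
    rw [this]
    exact Finset.measurable_sum _ fun i _ => measurable_gradSqAt i Ψ.ψ
  -- the constant: `ℓ⁻³ · L³ · 4πρ_μ²aℓ³(…) = 4πρ_μ²aL³(…)`
  have hconst : (ENNReal.ofReal ℓ ^ 3)⁻¹ * (Cst * ENNReal.ofReal L ^ 3) =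
      ENNReal.ofReal (4 * Real.pi * ρμ ^ 2 * a * L ^ 3 * (1 + C₀ * (ρμ * a ^ 3) ^ (1 / 2 : ℝ))) := by
    have hx : 0 ≤ (ρμ * a ^ 3) ^ (1 / 2 : ℝ) := Real.rpow_nonneg (by positivity) _
    have hℓ3ne : ℓ ^ 3 ≠ 0 := by positivity
    have hreal : (ℓ ^ 3)⁻¹ * (4 * Real.pi * ρμ ^ 2 * a * ℓ ^ 3 * (1 + C₀ * (ρμ * a ^ 3) ^ (1 / 2 : ℝ)) *
        L ^ 3) = 4 * Real.pi * ρμ ^ 2 * a * L ^ 3 * (1 + C₀ * (ρμ * a ^ 3) ^ (1 / 2 : ℝ)) := by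
      rw [inv_mul_eq_iff_eq_mul₀ hℓ3ne]
      ring
    rw [hCst, ← ENNReal.ofReal_pow hℓ0.le, ← ENNReal.ofReal_pow hL.le,
      ← ENNReal.ofReal_inv_of_pos (by positivity), ← ENNReal.ofReal_mul (by positivity),
      ← ENNReal.ofReal_mul (by positivity), hreal]
  -- assemble
  rw [hD, hB, ← hC, hconst] at hE
  -- hE : ofReal(8πaρμN) ≤ Tbar + Pot + const ;  hA : Tbar + g N ≤ Kin + g n₀
  have hfin : ENNReal.ofReal (8 * Real.pi * a * ρμ * (n + 1 : ℕ)) + g * (n + 1 : ℕ) ≤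
      periodicEnergy v Ψ + g * condensateOccupation (n + 1) L Ψ.ψ +
        ENNReal.ofReal (4 * Real.pi * ρμ ^ 2 * a * L ^ 3 * (1 + C₀ * (ρμ * a ^ 3) ^ (1 / 2 : ℝ))) := by
    calc ENNReal.ofReal (8 * Real.pi * a * ρμ * (n + 1 : ℕ)) + g * (n + 1 : ℕ)
        ≤ _ + g * (n + 1 : ℕ) := add_le_add hE le_rfl
      _ = (∑ i : Fin (n + 1), (ENNReal.ofReal L ^ 3)⁻¹ *
            ∫⁻ X in cellN (n + 1) L, (ENNReal.ofReal ℓ ^ 3)⁻¹ *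
              ∫⁻ u in cell L, kinLoc χ ℓ s₀ b u fun x => Ψ.ψ (Function.update X i x)) +
            g * (n + 1 : ℕ) +
          (∫⁻ X in cellN (n + 1) L, periodicInteraction v L X * (‖Ψ.ψ X‖₊ : ℝ≥0∞) ^ 2) +
          ENNReal.ofReal (4 * Real.pi * ρμ ^ 2 * a * L ^ 3 *
            (1 + C₀ * (ρμ * a ^ 3) ^ (1 / 2 : ℝ))) := by ring
      _ ≤ (∫⁻ X in cellN (n + 1) L, kineticDensity Ψ.ψ X) +
            g * condensateOccupation (n + 1) L Ψ.ψ +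
          (∫⁻ X in cellN (n + 1) L, periodicInteraction v L X * (‖Ψ.ψ X‖₊ : ℝ≥0∞) ^ 2) +
          ENNReal.ofReal (4 * Real.pi * ρμ ^ 2 * a * L ^ 3 *
            (1 + C₀ * (ρμ * a ^ 3) ^ (1 / 2 : ℝ))) := by gcongr
      _ = _ := by rw [hEn]; ring
  -- rewrite the left-hand side
  have hlhs : ENNReal.ofReal (2 * Real.pi ^ 2 / L ^ 2 * (n + 1 : ℕ) + 8 * Real.pi * a * ρμ * (n + 1 : ℕ)) =
      ENNReal.ofReal (8 * Real.pi * a * ρμ * (n + 1 : ℕ)) + g * (n + 1 : ℕ) := by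
    rw [add_comm, ENNReal.ofReal_add (by positivity) (by positivity), hg,
      ← ENNReal.ofReal_natCast (n + 1), ← ENNReal.ofReal_mul (by positivity)]
  rw [hlhs]
  exact hfin

end Assembly
/-- **Fournais 2020, Theorem 1.2 from the four printed ingredients of Theorem 3.1**:
Thm. 1.2 ⇐ (1.12) ⇐ Thm. 3.1 ⇐ {App. A, Lemma 3.2, Lemma 3.3, (3.17)}.
[cite: Fournais2020, Thm. 1.2, Thm. 3.1, Lemmas 3.2–3.3, (3.17)] -/
theorem Fournais2020_condensation_of_localization (hSS : LSSY2005_scatteringSolution)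
    (h33 : Fournais2020_lemma33) (h317 : Fournais2020_eq317) :
    Fournais2020_condensation :=
  Fournais2020_condensation_of_thm31 (Fournais2020_thm31_of_localization hSS h33 h317)

end Literature.MathematicalPhysics.QuantumManyBody.BoseGas

end
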